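import Summits.AtomisticToContinuum.BoseEinsteinCondensation.Theorems.BECCutLineWeakDisorderLandscapeBoundSiblingR3Defs
import Summits.AtomisticToContinuum.BoseEinsteinCondensation.Theorems.BECCutLineWeakDisorderLandscapeBoundSiblingCompose
import HarnessLib

/-!
# Route `BECCutLineWeakDisorder`, crux `LandscapeBound` (stmt-AtomisticToContinuum-9087),
# line `sibling-telescoping-chaining`, route R3: the reduction of the UV stub
# (registered bookkeeping stub `stub_uvReduction`)

Support file (`--supports stmt-AtomisticToContinuum-9087`; proves the registered bookkeeping stub
`stub_uvReduction : Goal.stub_uvReduction`, i.e.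
`GaussianStep → SmoothingBlock → BlockMassComparison → UVFlatness`, statements in
`Theorems/BECCutLineWeakDisorderLandscapeBoundSiblingR3Defs.lean`).

* uniformity of the block-kernel row bound at the unit scale (`rowBound_le`,
  `rowBound_le_rowBound₁`, `rowBound₁_ne_top`); the unit UV scale of the line
  `ℓ = L·2^{-depth L} ∈ (1/2, 1]` for `L ≥ 1` (`div_pow_depth_le_one`, `half_lt_div_pow_depth`,
  `one_le_sideLength`); the witness slice is a constant multiple of the partition-function slice
  and `r̄_K` is scale-free (`slice_witness_eq_const_mul`; `uvParticipation_const_mul`,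
  `fkWitness_eq_zero_of_normSq`, `coe_nnnorm_fkWitness` from `…SiblingCompose.lean`);
* `uvFlatness_of_parts` — slice by slice `g_Y = Z_T(·::Y) ≤ P_s F_Y` by (A), so
  `r̄_K(g_Y)² ≤ R₁(s)² S_K(F_Y)/S_K(g_Y)` by (B) at the unit scale; integrate against the slice law
  (mass `1`) and use the comparison: constant `(R₁(s)² + 1)·C`;
* `stub_uvReduction` — the registered stub.
-/

noncomputable section

open MeasureTheory ProbabilityTheory Filter Set Finset
open scoped ENNReal NNReal Topology BigOperators

namespace Summit.AtomisticToContinuum.BoseEinsteinCondensation.Cruxes.LandscapeBound.SiblingTelescopingChaining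

open Literature.MathematicalPhysics.QuantumManyBody.BoseGas
open Summit.AtomisticToContinuum.BoseEinsteinCondensation.Theses.BECCutLineWeakDisorder

namespace UVFlatnessR3

variable {n : ℕ}

/-! #### Uniformity of the constants at the unit scale `ℓ ∈ (1/2, 1]` -/

/-- The row bound is monotone in the block side through its two ingredients: for
`0 ≤ ℓ₁ ≤ ℓ ≤ ℓ₂`, `R(s, ℓ) ≤ (A(s,ℓ₂) · 2/(1 - q(s,ℓ₁)))³`. -/
theorem rowBound_le {s : ℝ≥0} {ℓ ℓ₁ ℓ₂ : ℝ} (hℓ₁ : 0 ≤ ℓ₁) (h1 : ℓ₁ ≤ ℓ) (h2 : ℓ ≤ ℓ₂) :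
    rowBound s ℓ ≤
      (ENNReal.ofReal (kerConst s ℓ₂) * (2 * (1 - ENNReal.ofReal (kerRatio s ℓ₁))⁻¹)) ^ 3 := by
  unfold rowBound
  have hℓ : 0 ≤ ℓ := hℓ₁.trans h1
  have hs4 : (0 : ℝ) ≤ 4 * s := by positivity
  have hA : kerConst s ℓ ≤ kerConst s ℓ₂ := by
    unfold kerConst
    refine mul_le_mul_of_nonneg_left (Real.exp_le_exp.2 ?_) (inv_nonneg.2 (Real.sqrt_nonneg _))
    exact div_le_div_of_nonneg_right (pow_le_pow_left₀ hℓ h2 2) hs4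
  have hq : kerRatio s ℓ ≤ kerRatio s ℓ₁ := by
    unfold kerRatio
    refine Real.exp_le_exp.2 (neg_le_neg ?_)
    exact div_le_div_of_nonneg_right (pow_le_pow_left₀ hℓ₁ h1 2) hs4
  refine pow_le_pow_left' (mul_le_mul' (ENNReal.ofReal_le_ofReal hA) (mul_le_mul' le_rfl ?_)) 3
  exact ENNReal.inv_le_inv.2 (tsub_le_tsub_left (ENNReal.ofReal_le_ofReal hq) 1)
/-- `rowBound_le_rowBound₁` (route R3 helper). -/
theorem rowBound_le_rowBound₁ {s : ℝ≥0} {ℓ : ℝ} (h1 : 1 / 2 ≤ ℓ) (h2 : ℓ ≤ 1) :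
    rowBound s ℓ ≤ rowBound₁ s :=
  rowBound_le (by norm_num) h1 h2

/-- `rowBound₁_ne_top` (route R3 helper). -/
theorem rowBound₁_ne_top {s : ℝ≥0} (hs : s ≠ 0) : rowBound₁ s ≠ ⊤ := by
  unfold rowBound₁
  refine ENNReal.pow_ne_top (ENNReal.mul_ne_top ENNReal.ofReal_ne_top
    (ENNReal.mul_ne_top (by norm_num) (ENNReal.inv_ne_top.2 ?_)))
  have hq : ENNReal.ofReal (kerRatio s (1 / 2)) < 1 :=
    ENNReal.ofReal_lt_one.2 (kerRatio_lt_one hs (by norm_num))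
  exact (tsub_pos_of_lt hq).ne'

/-! #### The unit UV scale of the line: `ℓ = L·2^{-depth L} ∈ (1/2, 1]` for `L ≥ 1` -/

/-- `div_pow_depth_le_one` (route R3 helper). -/
theorem div_pow_depth_le_one (L : ℝ) : L / 2 ^ depth L ≤ 1 := by
  have h2 : (0 : ℝ) < 2 ^ depth L := by positivity
  rw [div_le_one h2]
  have h1 : (⌈L⌉₊ : ℝ) ≤ (2 : ℝ) ^ depth L := by
    have := Nat.le_pow_clog one_lt_two ⌈L⌉₊
    unfold depth
    exact_mod_cast this
  exact (Nat.le_ceil L).trans h1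

/-- `half_lt_div_pow_depth` (route R3 helper). -/
theorem half_lt_div_pow_depth {L : ℝ} (hL : 1 ≤ L) : 1 / 2 < L / 2 ^ depth L := by
  have hL0 : 0 ≤ L := zero_le_one.trans hL
  have h2 : (0 : ℝ) < 2 ^ depth L := by positivity
  rw [lt_div_iff₀ h2]
  unfold depth
  by_cases h1 : ⌈L⌉₊ ≤ 1
  · rw [Nat.clog_of_right_le_one h1]
    norm_num
    linarith
  · have h1' : 1 < ⌈L⌉₊ := not_le.1 h1
    have hK : 0 < Nat.clog 2 ⌈L⌉₊ := Nat.clog_pos one_lt_two h1'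
    have hlt : 2 ^ (Nat.clog 2 ⌈L⌉₊).pred < ⌈L⌉₊ := Nat.pow_pred_clog_lt_self one_lt_two h1'
    have hceil : (⌈L⌉₊ : ℝ) < L + 1 := Nat.ceil_lt_add_one hL0
    have hlt' : (2 : ℝ) ^ (Nat.clog 2 ⌈L⌉₊).pred + 1 ≤ ⌈L⌉₊ := by
      have : 2 ^ (Nat.clog 2 ⌈L⌉₊).pred + 1 ≤ ⌈L⌉₊ := hlt
      exact_mod_cast this
    have hpow : (2 : ℝ) ^ Nat.clog 2 ⌈L⌉₊ = 2 * 2 ^ (Nat.clog 2 ⌈L⌉₊).pred := by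
      conv_lhs => rw [← Nat.succ_pred_eq_of_pos hK, pow_succ]
      ring
    rw [hpow]
    linarith

/-- The box of the route is eventually of side `≥ 1`: `1 ≤ sideLength ρ (n+1)` for `n ≥ ⌈ρ⌉`. -/
theorem one_le_sideLength {ρ : ℝ} (hρ : 0 < ρ) {n : ℕ} (hn : ⌈ρ⌉₊ ≤ n) : 1 ≤ sideLength ρ (n + 1) := by
  unfold sideLength
  refine Real.one_le_rpow ?_ (by norm_num)
  rw [le_div_iff₀ hρ, one_mul]
  have h1 : ρ ≤ (⌈ρ⌉₊ : ℝ) := Nat.le_ceil ρ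
  have h2 : (⌈ρ⌉₊ : ℝ) ≤ n := by exact_mod_cast hn
  push_cast
  linarith

/-! #### The witness slice is a constant multiple of the partition-function slice -/

/-- The witness slice is `(1/√‖Z_T‖₂²) · Z_T(x :: Y)` in `[0, ∞]`. -/
theorem slice_witness_eq_const_mul (v : ℝ → ℝ≥0∞) (L T : ℝ) (Y : Config n) (x : Space) :
    slice (fkWitness (N := n + 1) v L T (fun _ => (1 : ℝ≥0∞))) Y x =
      ENNReal.ofReal (1 / Real.sqrt (fkNormSq (N := n + 1) v L T (fun _ => (1 : ℝ≥0∞))).toReal) *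
        fkPartition v L T (Matrix.vecCons x Y) := by
  have hfin : fkPartition v L T (Matrix.vecCons x Y) ≠ ⊤ :=
    ne_top_of_le_ne_top ENNReal.one_ne_top (fkPartition_le_one v L T _)
  unfold slice
  rw [coe_nnnorm_fkWitness, fkWitness_apply, div_eq_mul_one_div,
    ENNReal.ofReal_mul ENNReal.toReal_nonneg]
  unfold fkPartition at hfin ⊢
  rw [ENNReal.ofReal_toReal hfin, mul_comm]

end UVFlatnessR3

/-! ### The reduction -/

open UVFlatnessR3 in
/-- **Route R3: (A) ∧ (B) ∧ `BlockMassComparison` ⇒ `UVFlatness`** (kernel-checked reduction; constant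
`C ↦ (R₁(s)² + 1)·C`). Slice by slice, `g_Y = Z_T(·::Y) ≤ P_s F_Y` by the one-step domination (A),
so `r̄_K(g_Y)² ≤ ℓ⁶ R(s,ℓ)² S_K(F_Y)/S_K(g_Y) ≤ R₁(s)² S_K(F_Y)/S_K(g_Y)` by the smoothing–block
inequality (B) at the unit scale `ℓ = L2^{-K} ∈ (1/2, 1]`; the witness slice is `Z_T(·::Y)/‖Z_T‖₂`
(`r̄` is scale-free) and the slice law has mass `‖Z_T‖₂²/‖Z_T‖₂² = 1`. -/
theorem uvFlatness_of_parts (hA : GaussianStep) (hB : SmoothingBlock) (h : BlockMassComparison) :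
    UVFlatness := by
  intro v hv
  obtain ⟨ρ₀, hρ₀, H⟩ := h v hv
  refine ⟨ρ₀, hρ₀, fun ρ hρ hρlt => ?_⟩
  obtain ⟨s, hs0, hs1, C, hC, hev⟩ := H ρ hρ hρlt
  have hs' : s.toNNReal ≠ 0 := by simpa [Real.toNNReal_eq_zero] using hs0
  set R : ℝ≥0∞ := rowBound₁ s.toNNReal with hRdef
  have hRtop : R ≠ ⊤ := rowBound₁_ne_top hs'
  have hR2top : R ^ 2 ≠ ⊤ := ENNReal.pow_ne_top hRtop
  refine ⟨((R ^ 2).toReal + 1) * C, by positivity, ?_⟩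
  filter_upwards [hev, eventually_ge_atTop ⌈ρ⌉₊] with n hn hnρ T hT
  have hvm : Measurable v := hv.1
  set L : ℝ := sideLength ρ (n + 1) with hLdef
  set K : ℕ := depth L with hKdef
  have hL : 0 < L := Real.rpow_pos_of_pos (div_pos (Nat.cast_pos.mpr n.succ_pos) hρ) _
  have hL1 : 1 ≤ L := one_le_sideLength hρ hnρ
  have hℓ1 : L / 2 ^ K ≤ 1 := div_pow_depth_le_one L
  have hℓ2 : 1 / 2 < L / 2 ^ K := half_lt_div_pow_depth hL1
  set Ψ : Config (n + 1) → ℝ := fkWitness (N := n + 1) v L T (fun _ => (1 : ℝ≥0∞)) with hΨdef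
  -- degenerate normalisation: the witness vanishes identically
  by_cases hdeg : fkNormSq (N := n + 1) v L T (fun _ => (1 : ℝ≥0∞)) = 0 ∨
      fkNormSq (N := n + 1) v L T (fun _ => (1 : ℝ≥0∞)) = ⊤
  · have hΨ0 : ∀ X, Ψ X = 0 := fkWitness_eq_zero_of_normSq hdeg
    have hsl : ∀ Y : Config n, slice Ψ Y = fun _ => 0 :=
      fun Y => funext fun x => by simp [slice, hΨ0]
    simp [hsl]
  simp only [not_or] at hdeg
  obtain ⟨h𝒩0, h𝒩t⟩ := hdeg
  set 𝒩 : ℝ≥0∞ := fkNormSq (N := n + 1) v L T (fun _ => (1 : ℝ≥0∞)) with h𝒩def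
  set c : ℝ≥0∞ := ENNReal.ofReal (1 / Real.sqrt 𝒩.toReal) with hcdef
  have h𝒩pos : 0 < 𝒩.toReal := ENNReal.toReal_pos h𝒩0 h𝒩t
  have hc0 : c ≠ 0 := (ENNReal.ofReal_pos.2 (by positivity)).ne'
  have hctop : c ≠ ⊤ := ENNReal.ofReal_ne_top
  have hc𝒩 : c ^ 2 * 𝒩 = 1 := by
    have hc2 : c ^ 2 = ENNReal.ofReal (𝒩.toReal)⁻¹ := by
      rw [hcdef, ← ENNReal.ofReal_pow (by positivity), one_div, inv_pow, Real.sq_sqrt h𝒩pos.le]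
    rw [hc2, ENNReal.ofReal_inv_of_pos h𝒩pos, ENNReal.ofReal_toReal h𝒩t,
      ENNReal.inv_mul_cancel h𝒩0 h𝒩t]
  -- the partition-function slice and its one-step majorant
  set Z : Config n → Space → ℝ≥0∞ := fun Y x => fkPartition v L T (Matrix.vecCons x Y) with hZdef
  set F : Config n → Space → ℝ≥0∞ := fun Y => stepMajorant v L s (T - s) Y with hFdef
  have hslice : ∀ Y, slice Ψ Y = fun x => c * Z Y x :=
    fun Y => funext (slice_witness_eq_const_mul v L T Y)
  -- slice by slice
  have hpt : ∀ Y, (∫⁻ x, slice Ψ Y x ^ 2) * uvParticipation (slice Ψ Y) L K ^ 2 ≤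
      (c ^ 2 * R ^ 2) * ((∫⁻ x, Z Y x ^ 2) * (levelSq (F Y) L K / levelSq (Z Y) L K)) := by
    intro Y
    rw [hslice Y, uvParticipation_const_mul hc0 hctop]
    have hm : ∫⁻ x, (c * Z Y x) ^ 2 = c ^ 2 * ∫⁻ x, Z Y x ^ 2 := by
      simp_rw [mul_pow]
      exact lintegral_const_mul' _ _ (ENNReal.pow_ne_top hctop)
    rw [hm]
    have hZm : Measurable (Z Y) := by
      have h1 : Measurable fun x : Space => Matrix.vecCons x Y :=
        measurable_vecCons.comp (measurable_id.prodMk measurable_const)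
      have h2 := (measurable_fkSemigroup hvm L T (measurable_const (a := (1 : ℝ≥0∞)))).comp h1
      exact h2
    have hFm : Measurable (F Y) := measurable_stepMajorant hvm L s (T - s) Y
    have hZ0 : ∀ x, x ∉ box L → Z Y x = 0 := fun x hx =>
      fkSemigroup_of_notMem v (by linarith) _ fun hX => hx (by simpa using hX 0)
    have hF0 : ∀ z, z ∉ box L → F Y z = 0 := fun z hz =>
      stepMajorant_of_notMem v L s (by linarith) Y hz
    have hdom : ∀ x, Z Y x ≤ ∫⁻ z, heat s.toNNReal x z * F Y z := by
      intro x
      have h1 := hA n v hvm L s hs0 (T - s) (by linarith) x Y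
      rwa [add_sub_cancel] at h1
    have huv : uvParticipation (Z Y) L K ^ 2 ≤ R ^ 2 * (levelSq (F Y) L K / levelSq (Z Y) L K) := by
      calc uvParticipation (Z Y) L K ^ 2
          ≤ ENNReal.ofReal ((L / 2 ^ K) ^ 3) ^ 2 * rowBound s.toNNReal (L / 2 ^ K) ^ 2 *
              (levelSq (F Y) L K / levelSq (Z Y) L K) :=
            hB L hL K _ hs' _ _ hZm hFm hZ0 hF0 hdom
        _ ≤ 1 ^ 2 * R ^ 2 * (levelSq (F Y) L K / levelSq (Z Y) L K) := by
            refine mul_le_mul' (mul_le_mul' (pow_le_pow_left' ?_ 2) (pow_le_pow_left' ?_ 2)) le_rfl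
            · exact ENNReal.ofReal_le_one.2 (pow_le_one₀ (by linarith) hℓ1)
            · exact rowBound_le_rowBound₁ hℓ2.le hℓ1
        _ = _ := by rw [one_pow, one_mul]
    calc c ^ 2 * (∫⁻ x, Z Y x ^ 2) * uvParticipation (Z Y) L K ^ 2
        ≤ c ^ 2 * (∫⁻ x, Z Y x ^ 2) * (R ^ 2 * (levelSq (F Y) L K / levelSq (Z Y) L K)) :=
          mul_le_mul' le_rfl huv
      _ = _ := by ring
  -- integrate over the slices
  calc ∫⁻ Y, (∫⁻ x, slice Ψ Y x ^ 2) * uvParticipation (slice Ψ Y) L K ^ 2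
      ≤ ∫⁻ Y, (c ^ 2 * R ^ 2) * ((∫⁻ x, Z Y x ^ 2) * (levelSq (F Y) L K / levelSq (Z Y) L K)) :=
        lintegral_mono hpt
    _ = (c ^ 2 * R ^ 2) * ∫⁻ Y, (∫⁻ x, Z Y x ^ 2) * (levelSq (F Y) L K / levelSq (Z Y) L K) :=
        lintegral_const_mul' _ _ (ENNReal.mul_ne_top (ENNReal.pow_ne_top hctop) hR2top)
    _ ≤ (c ^ 2 * R ^ 2) * (ENNReal.ofReal C * 𝒩) := mul_le_mul' le_rfl (hn T hT)
    _ = R ^ 2 * ENNReal.ofReal C * (c ^ 2 * 𝒩) := by ring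
    _ = ENNReal.ofReal (R ^ 2).toReal * ENNReal.ofReal C := by
        rw [hc𝒩, mul_one, ENNReal.ofReal_toReal hR2top]
    _ ≤ ENNReal.ofReal ((R ^ 2).toReal + 1) * ENNReal.ofReal C :=
        mul_le_mul' (ENNReal.ofReal_le_ofReal (by linarith)) le_rfl
    _ = ENNReal.ofReal (((R ^ 2).toReal + 1) * C) :=
        (ENNReal.ofReal_mul (by positivity)).symm



/-- PROVED bookkeeping stub `stub_uvReduction`. -/
theorem stub_uvReduction : Goal.stub_uvReduction :=
  fun hA hB hC => uvFlatness_of_parts hA hB hC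

end Summit.AtomisticToContinuum.BoseEinsteinCondensation.Cruxes.LandscapeBound.SiblingTelescopingChaining

end
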